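import Summits.QuantumFields.YangMills.Theorems.IR.AfPincerUcTypChainPeierls
import Summits.QuantumFields.YangMills.Theorems.IR.AfPincerUcTypChainSupplier
import Summits.QuantumFields.YangMills.Theorems.BalabanLadderIROddTorusLargeFieldRaritySharp
import Summits.QuantumFields.YangMills.Theorems.BalabanLadderIRTypExcessSparseAnchor
import HarnessLib

/-!
# Crux `IR` (stmt-QuantumFields-19354), line `af-pincer-Uc`: PEIERLS RARITY OF LONG BAD CHAINS for the short-chain class
# `TypChain` (2/2) — clause (iii), THE TORUS ANCHOR, PROVED for `TypChain` from the odd-torus chessboard estimate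

Helper module for item `stmt-QuantumFields-19354` (`--supports … --as helper`; it closes nothing).  Sequel of
`Theorems/IR/AfPincerUcTypChainPeierls.lean` (abstract hereditary Peierls bound `measure_forall_hasBadChainAmong_le_pow`): here the
sparseness hypothesis is SUPPLIED on the torus and clause (iii) of the format `TypShellCondUKPc` («torus anchor»: on every odd torus
`2S+1 ≥ 4b`, for every finite set `F` of cells inside `[-S, S]⁴`, `μ_{2S+1,β}{V | ∀ c ∈ F, torusLift V ∉ Typ c} ≤ δ ^ #F`) is PROVED for
the LEAD's R107/R109-compliant class `Typ = SharpLanes.TypChain r.ρ θ w ℓ₀` — the (iii)-conjunct of the supplier statement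
`TypChainSharpSC` of LANES-R104 rev 3 §7b for `stub_onsetSharpSC` (slot «sharp merge I♯_SC» 28967a1bf60ad397).

* `torus_plaqSet_sparse` — sparseness of bad plaquette SETS under the torus Wilson states: the tree's Fröhlich–Israel–Lieb–Simon
  chessboard rarity on the odd torus (`OddTorusChessboard.measureReal_forall_le_cellAction_le_pow_rep_sharp`, same route, Chebyshev
  parameter `λ = β`) at SINGLETON cells, transported along the injective projection `[-S, S]⁴ → (ℤ/(2S+1))⁴`:
  `μ_{2S+1,β}{∀ p ∈ X, θ ≤ plaqAction (lift)} ≤ (e^{(K₀ + D₁ log β − βθ)/6})^{#X}`; `exists_log_absorb` + `torus_plaqSet_sparse_exp`: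
  `≤ (e^{−θβ/12})^{#X}` for `β ≥ β₁(r, θ)`.
* **`clauseIII_typChain` (PROVED)**: for `β ≥ β₁`, `b ≥ 1` and every `ℓ₀, δ` meeting the explicit budget
  `3750 q ≤ 1/2 ∧ 192 b⁴ q (3750 q)^{⌈ℓ₀/2⌉} ≤ δ`, `q = e^{−θβ/12}`, EVERY mesh-`b` frame `w` has `ClauseIII r.ρ β w b δ (TypChain r.ρ θ w ℓ₀)`
  (the abstract bound with `Φ = torusLift (2S+1)`, `n = 96 b⁴ ≥ #cellPlaqs`, cells disjoint, all plaquettes based in `[-S, S]⁴`).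
* **`exists_extent_clauseIII_typChain`** — the same in the SUPPLIER'S QUANTIFIER ORDER for exponential meshes `b ≤ B e^{Cβ}` (the sharp
  mesh `b < T(δ)/a(β)` of I♯_SC whenever the unit decays at most exponentially, `a(β) ≥ A₀ e^{−Cβ}`; `B = T(δ)/A₀` may depend on `δ`):
  ONE extent `ℓ₀ = 2⌈48 C⁺/θ⌉₊`, chosen BEFORE `δ`, serves every `δ > 0` and every `B` for `β ≥ β₂(δ, B)` — R109 (4) «`ℓ₀ ≥ 6` at
  `b ≍ ξ`» made quantitative (`ℓ₀ ≍ 96 C/θ`).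

* `typChainSharpSC_of_clauses_expMesh` — PRESS-BUTTON: the LEAD's supplier statement `TypChainSharpSC` (`Theorems/IR/AfPincerUcTypChainSupplier`,
  p-landed 14:49Z) from its clauses (i) + (ii) alone at exponential meshes, (iii) supplied by this file; with
  `onsetSharpUKPcSC_of_typChainSharpSC` / `ir_of_typChainSharpSC` the stub and the route decl follow by name.

NOT done here: clause (ii) beyond the by-name reduction of the prequel, and clause (i) (R107 (c)) — the open content of `stub_onsetSharpSC`.
HONEST FRAMING: one SOFT conjunct ((iii)) of one supplier format of ONE open stub of a CONDITIONAL chain (Track A 0/28 UV) is discharged;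
nothing of weak-coupling mixing, asymptotic freedom or a gap is proved or claimed; not infinite volume, not Clay.  No `sorry`; axioms ⊆
{propext, Classical.choice, Quot.sound}.  References: Fröhlich–Israel–Lieb–Simon, CMP 62 (1978) Thm 4.1, §5; E. Seiler, LNP 159 (1982) Ch. 4;
R. Peierls (1936).
-/

set_option autoImplicit false

noncomputable section

open Filter Topology MeasureTheory
open Literature.MathematicalPhysics.QuantumFieldTheory hiding ZdEdge
open Summit.QuantumFields.YangMills.Cruxes.OSLegsFromFemtoAndGap.DlrCollarTransfer (LowerBounds)
open Literature.MathematicalPhysics.QuantumLattice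
open Literature.Probability.LatticeModels (Site)
open Summit.QuantumFields.YangMills.Theorems.OddTorusChessboard (cellPlaqs plaqAction cellSites projPlaq
  fst_mem_cellSites_of_mem_cellPlaqs cellSites_subset_box projPlaq_injOn_box card_cellPlaqs_le Orient
  card_orient_four plaquetteCost_projPlaq_eq_plaqAction measureReal_forall_le_cellAction_le_pow_rep_sharp)

namespace Summit.QuantumFields.YangMills.Cruxes.IR.AfPincerUc.SharpLanes

open Summit.QuantumFields.YangMills.Cruxes.IR.AfPincerUc

/-! ## Clause (iii) — the TORUS ANCHOR — for `TypChain`, discharged from the tree's odd-torus chessboard rarity -/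
section Torus

variable {G : Type} [Group G] [TopologicalSpace G] [IsTopologicalGroup G] [CompactSpace G]
  [MeasurableSpace G] [BorelSpace G]

/-- **Sparseness of bad plaquette SETS under the torus Wilson states (chessboard).**  For a lattice representation `r`
there are `K₀, D₁` such that for all `β ≥ 1`, all `S ≥ 1`, every threshold `θ` and every finite set `X` of plaquettes of
`ℤ⁴` based in the fundamental domain `[-S, S]⁴`:
`μ_{2S+1,β} {V | ∀ p ∈ X, θ ≤ plaqAction r.ρ p (torusLift (2S+1) V)} ≤ (exp((K₀ + D₁ log β − β θ)/6)) ^ #X`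
— the tree's sharp hereditary large-field rarity `OddTorusChessboard.measureReal_forall_le_cellAction_le_pow_rep_sharp`
(Fröhlich–Israel–Lieb–Simon chessboard on the odd torus, Chebyshev parameter `λ = β`) at singleton cells, transported
along the injective projection of `[-S, S]⁴` to the torus. -/
theorem torus_plaqSet_sparse (r : LatticeRep G) :
    ∃ K₀ : ℝ, ∃ D₁ : ℕ, ∀ (β : ℝ), 1 ≤ β → ∀ (S : ℕ), 1 ≤ S → ∀ (θ : ℝ) (X : Finset (ZdPlaquette 4)),
      (∀ p ∈ X, p.1 ∈ Literature.Probability.LatticeModels.box 4 S) →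
        (wilsonMeasure (d := 4) (L := 2 * S + 1) r.ρ β)
            {V : GaugeConfig 4 (2 * S + 1) G | ∀ p ∈ X, θ ≤ plaqAction r.ρ p (torusLift (2 * S + 1) V)} ≤
          ENNReal.ofReal (Real.exp ((K₀ + D₁ * Real.log β - β * θ) / 6) ^ X.card) := by
  classical
  obtain ⟨K₀, D₁, h⟩ := measureReal_forall_le_cellAction_le_pow_rep_sharp r
  refine ⟨K₀, D₁, fun β hβ S hS θ X hX => ?_⟩
  have hL : Odd (2 * S + 1) := ⟨S, rfl⟩
  have hL3 : 3 ≤ 2 * S + 1 := by omega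
  haveI := isProbabilityMeasure_wilsonMeasure (d := 4) (L := 2 * S + 1) (G := G) r.ρ r.continuous β
  -- the torus image of `X`
  set X' : Finset (Plaquette 4 (2 * S + 1)) := X.image (projPlaq (2 * S + 1)) with hX'
  have hinj : Set.InjOn (projPlaq (2 * S + 1)) ↑X := fun q hq q' hq' hqq =>
    projPlaq_injOn_box S (hX q hq) (hX q' hq') hqq
  have hcard : X'.card = X.card := Finset.card_image_of_injOn hinj
  -- the event on the torus
  have hev : {V : GaugeConfig 4 (2 * S + 1) G | ∀ p ∈ X, θ ≤ plaqAction r.ρ p (torusLift (2 * S + 1) V)} =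
      {U | ∀ i ∈ X', θ ≤ ∑ q ∈ ({i} : Finset (Plaquette 4 (2 * S + 1))), plaquetteCost r.ρ U q} := by
    ext V
    simp only [Set.mem_setOf_eq, hX', Finset.forall_mem_image, Finset.sum_singleton, plaquetteCost_projPlaq_eq_plaqAction]
  have hdisj : ∀ i ∈ X', ∀ j ∈ X', i ≠ j →
      Disjoint ({i} : Finset (Plaquette 4 (2 * S + 1))) ({j} : Finset (Plaquette 4 (2 * S + 1))) :=
    fun i _ j _ hij => Finset.disjoint_singleton.2 hij
  have hn : ∀ i ∈ X', (({i} : Finset (Plaquette 4 (2 * S + 1)))).card ≤ 1 := fun i _ => by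
    rw [Finset.card_singleton]
  have hmain := h hL hL3 β hβ β (by linarith) le_rfl X' (fun i => ({i} : Finset (Plaquette 4 (2 * S + 1)))) hdisj 1 hn θ
  rw [hev, ← ofReal_measureReal]
  refine ENNReal.ofReal_le_ofReal (hmain.trans (le_of_eq ?_))
  rw [hcard, card_orient_four]
  congr 1
  congr 1
  push_cast
  ring

/-- Absorbing the logarithm: for `θ > 0` there is `β₁ ≥ 1` with `K₀ + D₁ log β ≤ θ β / 2` for all `β ≥ β₁`. -/
theorem exists_log_absorb (K₀ : ℝ) (D₁ : ℕ) {θ : ℝ} (hθ : 0 < θ) :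
    ∃ β₁ : ℝ, 1 ≤ β₁ ∧ ∀ β : ℝ, β₁ ≤ β → K₀ + D₁ * Real.log β ≤ θ * β / 2 := by
  refine ⟨max 1 (max (4 * K₀ / θ) ((8 * D₁ / θ) ^ 2)), le_max_left _ _, fun β hβ => ?_⟩
  have hβ1 : 1 ≤ β := le_trans (le_max_left _ _) hβ
  have hβK : 4 * K₀ / θ ≤ β := le_trans (le_trans (le_max_left _ _) (le_max_right _ _)) hβ
  have hβD : (8 * D₁ / θ) ^ 2 ≤ β := le_trans (le_trans (le_max_right _ _) (le_max_right _ _)) hβ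
  have hβ0 : 0 < β := by linarith
  have hD0 : (0 : ℝ) ≤ D₁ := Nat.cast_nonneg _
  -- `K₀ ≤ θ β / 4`
  have hK : K₀ ≤ θ * β / 4 := by
    rw [div_le_iff₀ hθ] at hβK
    linarith
  -- `D₁ log β ≤ 2 D₁ √β ≤ θ β / 4`
  have hsq : 8 * D₁ / θ ≤ Real.sqrt β := by
    have h := Real.sqrt_le_sqrt hβD
    rwa [Real.sqrt_sq (by positivity)] at h
  have hlog : D₁ * Real.log β ≤ θ * β / 4 := by
    -- `log β ≤ 2 √β` (from `log x ≤ x − 1` at `√β`; inlined, cf. the tree's `log_le_two_mul_sqrt`s)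
    have hls : Real.log β ≤ 2 * Real.sqrt β := by
      have h1 : Real.log (Real.sqrt β) ≤ Real.sqrt β - 1 := Real.log_le_sub_one_of_pos (Real.sqrt_pos.2 hβ0)
      rw [Real.log_sqrt hβ0.le] at h1
      linarith
    have h1 : D₁ * Real.log β ≤ D₁ * (2 * Real.sqrt β) := mul_le_mul_of_nonneg_left hls hD0
    have h2 : D₁ * (2 * Real.sqrt β) ≤ θ * β / 4 := by
      have h3 : (8 * D₁ / θ) * Real.sqrt β ≤ Real.sqrt β * Real.sqrt β :=
        mul_le_mul_of_nonneg_right hsq (Real.sqrt_nonneg _)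
      rw [Real.mul_self_sqrt hβ0.le] at h3
      rw [div_mul_eq_mul_div, div_le_iff₀ hθ] at h3
      linarith
    exact h1.trans h2
  linarith

/-- **Sparseness of bad plaquette sets on the torus, pure-exponential form**: for `θ > 0` there is `β₁` such that for
`β ≥ β₁`, `S ≥ 1` and every `X` based in `[-S, S]⁴`,
`μ_{2S+1,β} {V | ∀ p ∈ X, θ ≤ plaqAction r.ρ p (torusLift V)} ≤ (exp(−θ β / 12)) ^ #X`. -/
theorem torus_plaqSet_sparse_exp (r : LatticeRep G) {θ : ℝ} (hθ : 0 < θ) :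
    ∃ β₁ : ℝ, 1 ≤ β₁ ∧ ∀ (β : ℝ), β₁ ≤ β → ∀ (S : ℕ), 1 ≤ S → ∀ X : Finset (ZdPlaquette 4),
      (∀ p ∈ X, p.1 ∈ Literature.Probability.LatticeModels.box 4 S) →
        (wilsonMeasure (d := 4) (L := 2 * S + 1) r.ρ β)
            {V : GaugeConfig 4 (2 * S + 1) G | ∀ p ∈ X, θ ≤ plaqAction r.ρ p (torusLift (2 * S + 1) V)} ≤
          ENNReal.ofReal (Real.exp (-(θ / 12 * β)) ^ X.card) := by
  obtain ⟨K₀, D₁, h⟩ := torus_plaqSet_sparse (G := G) r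
  obtain ⟨β₁, hβ₁, habs⟩ := exists_log_absorb K₀ D₁ hθ
  refine ⟨β₁, hβ₁, fun β hβ S hS X hX => (h β (hβ₁.trans hβ) S hS θ X hX).trans (ENNReal.ofReal_le_ofReal ?_)⟩
  refine pow_le_pow_left₀ (Real.exp_pos _).le (Real.exp_le_exp.2 ?_) _
  have := habs β hβ
  linarith

/-- **CLAUSE (iii) — THE TORUS ANCHOR — FOR THE SHORT-CHAIN CLASS `TypChain` (PROVED), explicit budget.**  For a lattice
representation `r` and a badness threshold `θ > 0` there is `β₁` such that for every `β ≥ β₁`, every mesh `b ≥ 1`, every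
tolerated extent `ℓ₀` and every `δ` with, writing `q = exp(−θ β / 12)`,
`3750 q ≤ 1/2` and `192 b⁴ q (3750 q)^{⌈ℓ₀/2⌉} ≤ δ`,
the family `TypChain r.ρ θ w ℓ₀` satisfies `ClauseIII r.ρ β w b δ` on every mesh-`b` frame `w`: on every odd torus
`2S+1 ≥ 4b`, for every finite set `F` of cells inside `[-S, S]⁴`, all cells of `F` carry a `θ`-bad chain of extent `≥ ℓ₀`
among their own plaquettes with `μ_{2S+1,β}`-probability `≤ δ ^ #F` (hereditary Peierls bound `measure_forall_hasBadChainAmong_le_pow`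
over the torus sparseness `torus_plaqSet_sparse_exp`; a cell has `≤ 6 (2b)⁴ = 96 b⁴` plaquettes).  At the sharp mesh
`b ≍ 1/a(β) ≍ e^{Cβ}` the budget is met with `ℓ₀ = O(C/θ)` FIXED (`exists_extent_clauseIII_typChain`). -/
theorem clauseIII_typChain (r : LatticeRep G) {θ : ℝ} (hθ : 0 < θ) :
    ∃ β₁ : ℝ, ∀ β : ℝ, β₁ ≤ β → ∀ (b ℓ₀ : ℕ) (δ : ℝ), 1 ≤ b →
      3750 * Real.exp (-(θ / 12 * β)) ≤ 1 / 2 →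
        192 * (b : ℝ) ^ 4 * Real.exp (-(θ / 12 * β)) * (3750 * Real.exp (-(θ / 12 * β))) ^ ((ℓ₀ + 1) / 2) ≤ δ →
          ∀ w : Fin 4 → ℤ → ℤ, IsFrame b w → ClauseIII r.ρ β w b δ (TypChain r.ρ θ w ℓ₀) := by
  classical
  obtain ⟨β₁, -, hsp⟩ := torus_plaqSet_sparse_exp (G := G) r hθ
  refine ⟨β₁, fun β hβ b ℓ₀ δ hb hhalf hbudget w hw S hS F _ hin => ?_⟩
  have hS1 : 1 ≤ S := by omega
  set q : ℝ := Real.exp (-(θ / 12 * β)) with hq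
  have hq0 : 0 ≤ q := (Real.exp_pos _).le
  -- the cells, their universe, disjointness and size
  have hP𝒰 : ∀ c ∈ F, cellPlaqs w c ⊆ F.biUnion (cellPlaqs w) := fun c hc => Finset.subset_biUnion_of_mem _ hc
  have hdisj : ∀ c ∈ F, ∀ c' ∈ F, c ≠ c' → Disjoint (cellPlaqs w c) (cellPlaqs w c') :=
    fun c _ c' _ hcc => disjoint_cellPlaqs hw hcc
  have hn : ∀ c ∈ F, (cellPlaqs w c).card ≤ 96 * b ^ 4 := fun c _ => by
    have h := card_cellPlaqs_le hw c
    rw [card_orient_four] at h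
    calc (cellPlaqs w c).card ≤ (2 * b) ^ 4 * 6 := h
      _ = 96 * b ^ 4 := by ring
  -- sparseness on the universe (all its plaquettes are based in `[-S, S]⁴`)
  have hsp' : ∀ X : Finset (ZdPlaquette 4), X ⊆ F.biUnion (cellPlaqs w) →
      (wilsonMeasure (d := 4) (L := 2 * S + 1) r.ρ β)
          {V : GaugeConfig 4 (2 * S + 1) G | ∀ p ∈ X, θ ≤ plaqAction r.ρ p (torusLift (2 * S + 1) V)} ≤
        ENNReal.ofReal (q ^ X.card) := by
    intro X hX
    refine hsp β hβ S hS1 X fun p hp => ?_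
    obtain ⟨c, hc, hpc⟩ := Finset.mem_biUnion.1 (hX hp)
    exact cellSites_subset_box (hin c hc) _ (fst_mem_cellSites_of_mem_cellPlaqs hpc)
  have hmain := measure_forall_hasBadChainAmong_le_pow r.ρ (wilsonMeasure (d := 4) (L := 2 * S + 1) r.ρ β)
    (torusLift (2 * S + 1)) θ F (cellPlaqs w) (F.biUnion (cellPlaqs w)) hP𝒰 hdisj hn hq0 hhalf hsp' ℓ₀
  have hev : {V : GaugeConfig 4 (2 * S + 1) G | ∀ c ∈ F, torusLift (2 * S + 1) V ∉ TypChain r.ρ θ w ℓ₀ c} =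
      {V | ∀ c ∈ F, HasBadChainAmong r.ρ θ (↑(cellPlaqs w c)) ℓ₀ (torusLift (2 * S + 1) V)} := by
    ext V
    simp only [Set.mem_setOf_eq, TypChain, not_not]
  rw [hev]
  refine hmain.trans (ENNReal.ofReal_le_ofReal (pow_le_pow_left₀ (by positivity) ?_ _))
  calc 2 * ((96 * b ^ 4 : ℕ) : ℝ) * q * (3750 * q) ^ ((ℓ₀ + 1) / 2)
      = 192 * (b : ℝ) ^ 4 * q * (3750 * q) ^ ((ℓ₀ + 1) / 2) := by push_cast; ring
    _ ≤ δ := hbudget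

/-- **Clause (iii) for `TypChain` in the SUPPLIER'S QUANTIFIER ORDER, exponential meshes.**  For `θ > 0` and a growth
rate `C` there is a FIXED tolerated extent `ℓ₀` (explicitly `ℓ₀ = 2 ⌈48 C⁺/θ⌉₊`, a function of `C⁺/θ` alone) such that for every
`δ > 0` and every prefactor `B` (which may depend on `δ`) there is `β₂` with: for all `β ≥ β₂`, every mesh `1 ≤ b ≤ B e^{C β}` and
every mesh-`b` frame `w`, `ClauseIII r.ρ β w b δ (TypChain r.ρ θ w ℓ₀)`.  This is the (iii)-conjunct of the LEAD's next supplier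
statement `TypChainSharpSC` (LANES-R104 rev 3 §7b: `∃ (n, ε, θ, ℓ₀) ∀ δ ∃ T β₂ ∀ β ≥ β₂ ∃ b ≥ 1, a β · b < T ∧ …`) at the sharp
mesh `b < T(δ)/a(β)`, for every unit decaying at most exponentially, `a(β) ≥ A₀ e^{−Cβ}`: take `B = T(δ)/A₀`.  R109 (4) «`ℓ₀ ≥ 6`
at `b ≍ ξ`» made quantitative: `ℓ₀ ≍ 96 C/θ` with these (crude) constants. -/
theorem exists_extent_clauseIII_typChain (r : LatticeRep G) {θ : ℝ} (hθ : 0 < θ) (C : ℝ) :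
    ∃ ℓ₀ : ℕ, ∀ δ : ℝ, 0 < δ → ∀ B : ℝ, ∃ β₂ : ℝ, ∀ β : ℝ, β₂ ≤ β → ∀ b : ℕ, 1 ≤ b →
      (b : ℝ) ≤ B * Real.exp (C * β) → ∀ w : Fin 4 → ℤ → ℤ, IsFrame b w → ClauseIII r.ρ β w b δ (TypChain r.ρ θ w ℓ₀) := by
  obtain ⟨β₁, h⟩ := clauseIII_typChain (G := G) r hθ
  -- positive envelope of the rate; the extent depends on `C⁺/θ` only
  set C' : ℝ := max C 0 with hC'
  have hC'0 : 0 ≤ C' := le_max_right _ _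
  set K₀ : ℕ := ⌈48 * C' / θ⌉₊ with hK₀
  have hK₀ge : 48 * C' / θ ≤ K₀ := Nat.le_ceil _
  refine ⟨2 * K₀, fun δ hδ B => ?_⟩
  -- positive envelope of the prefactor (it only moves `β₂`)
  set B' : ℝ := max B 1 with hB'
  have hB'0 : 0 ≤ B' := le_trans zero_le_one (le_max_right _ _)
  set M : ℝ := 192 * B' ^ 4 * 3750 ^ K₀ with hM
  have hM0 : 0 < M := by positivity
  refine ⟨max (max β₁ 0) (max (12 / θ * Real.log 7500) (12 / θ * Real.log (M / δ))),
    fun β hβ b hb hbB w hw => ?_⟩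
  have hβ1 : β₁ ≤ β := le_trans (le_trans (le_max_left _ _) (le_max_left _ _)) hβ
  have hβ0 : 0 ≤ β := le_trans (le_trans (le_max_right _ _) (le_max_left _ _)) hβ
  have hβh : 12 / θ * Real.log 7500 ≤ β := le_trans (le_trans (le_max_left _ _) (le_max_right _ _)) hβ
  have hβM : 12 / θ * Real.log (M / δ) ≤ β := le_trans (le_trans (le_max_right _ _) (le_max_right _ _)) hβ
  set q : ℝ := Real.exp (-(θ / 12 * β)) with hq
  have hq0 : 0 < q := Real.exp_pos _
  have e12 : θ / 12 * β = θ * β / 12 := by ring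
  -- `3750 q ≤ 1/2`
  have hhalf : 3750 * q ≤ 1 / 2 := by
    have hθβ : 12 * Real.log 7500 ≤ θ * β := by
      rw [div_mul_eq_mul_div] at hβh
      exact (div_le_iff₀' hθ).1 hβh
    have h1 : -(θ / 12 * β) ≤ Real.log (1 / 7500) := by
      rw [one_div, Real.log_inv, e12]
      linarith
    have h2 : q ≤ 1 / 7500 := by
      rw [hq, ← Real.exp_log (by norm_num : (0 : ℝ) < 1 / 7500)]
      exact Real.exp_le_exp.2 h1
    linarith
  -- the budget
  have hbudget : 192 * (b : ℝ) ^ 4 * q * (3750 * q) ^ ((2 * K₀ + 1) / 2) ≤ δ := by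
    have hK : (2 * K₀ + 1) / 2 = K₀ := by omega
    rw [hK]
    -- `b ≤ B' e^{C' β}`
    have hbB' : (b : ℝ) ≤ B' * Real.exp (C' * β) := by
      refine hbB.trans ?_
      rcases le_or_gt B 0 with hB0 | hB0
      · exact le_trans (mul_nonpos_iff.2 (Or.inr ⟨hB0, (Real.exp_pos _).le⟩)) (by positivity)
      · exact mul_le_mul (le_max_left _ _)
          (Real.exp_le_exp.2 (mul_le_mul_of_nonneg_right (le_max_left C 0) hβ0)) (Real.exp_pos _).le hB'0
    have hb0 : (0 : ℝ) ≤ b := Nat.cast_nonneg _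
    have hb4 : (b : ℝ) ^ 4 ≤ B' ^ 4 * Real.exp (4 * C' * β) := by
      calc (b : ℝ) ^ 4 ≤ (B' * Real.exp (C' * β)) ^ 4 := pow_le_pow_left₀ hb0 hbB' 4
        _ = B' ^ 4 * Real.exp (4 * C' * β) := by
          rw [mul_pow, ← Real.exp_nat_mul]
          congr 2
          push_cast
          ring
    -- rate comparison: `e^{4C'β} q^{K₀+1} ≤ q` since `48 C'/θ ≤ K₀`
    have hrate : Real.exp (4 * C' * β) * q ^ (K₀ + 1) ≤ q := by
      rw [hq, ← Real.exp_nat_mul, ← Real.exp_add]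
      refine Real.exp_le_exp.2 ?_
      have h1 : 48 * C' ≤ (K₀ : ℝ) * θ := (div_le_iff₀ hθ).1 hK₀ge
      have h2 : 0 ≤ ((K₀ : ℝ) * θ - 48 * C') * β := mul_nonneg (by linarith) hβ0
      push_cast
      nlinarith
    -- `M q ≤ δ` from `β ≥ (12/θ) log (M/δ)`
    have hMq : M * q ≤ δ := by
      have hθβ : 12 * Real.log (M / δ) ≤ θ * β := by
        rw [div_mul_eq_mul_div] at hβM
        exact (div_le_iff₀' hθ).1 hβM
      have h1 : -(θ / 12 * β) ≤ Real.log (δ / M) := by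
        rw [Real.log_div hδ.ne' hM0.ne', e12]
        rw [Real.log_div hM0.ne' hδ.ne'] at hθβ
        linarith
      have h2 : q ≤ δ / M := by
        rw [hq, ← Real.exp_log (div_pos hδ hM0)]
        exact Real.exp_le_exp.2 h1
      rwa [le_div_iff₀ hM0, mul_comm] at h2
    calc 192 * (b : ℝ) ^ 4 * q * (3750 * q) ^ K₀
        = 192 * 3750 ^ K₀ * (b : ℝ) ^ 4 * q ^ (K₀ + 1) := by ring
      _ ≤ 192 * 3750 ^ K₀ * (B' ^ 4 * Real.exp (4 * C' * β)) * q ^ (K₀ + 1) := by gcongr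
      _ = M * (Real.exp (4 * C' * β) * q ^ (K₀ + 1)) := by rw [hM]; ring
      _ ≤ M * q := by gcongr
      _ ≤ δ := hMq
  exact h β hβ1 b (2 * K₀) δ hb hhalf hbudget w hw

end Torus

/-! ## Press-button: the LEAD's `TypChainSharpSC` from clauses (i) + (ii) at exponential meshes — (iii) supplied here -/
section PressButton

/-- **`TypChainSharpSC` from its clauses (i) and (ii) alone, at exponential meshes (PROVED glue; (iii) = `exists_extent_clauseIII_typChain`).**
If for every simply connected compact simple `G`, `r`, positive unit `a → 0` with `LowerBounds G r a` a supplier names admissible `(n, ε)`,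
a threshold `θ > 0` and a mesh growth rate `C`, and delivers — for EVERY tolerated extent `ℓ₀` and every budget `δ > 0` — a window `T`,
a prefactor `B` and `β₂` such that for `β ≥ β₂` some mesh `1 ≤ b ≤ B e^{Cβ}` with `a β · b < T` carries clause (i) at every centre and
clause (ii) in UKP form for `TypChain r.ρ θ w ℓ₀` on every mesh-`b` frame, then `TypChainSharpSC` holds (hence I♯_SC and, with the
residual, `IR`: `onsetSharpUKPcSC_of_typChainSharpSC`, `ir_of_typChainSharpSC`).  The extent of record is `ℓ₀ = 2⌈48 C⁺/θ⌉₊`. -/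
theorem typChainSharpSC_of_clauses_expMesh
    (h : ∀ (G : Type) [Group G] [TopologicalSpace G] [IsTopologicalGroup G] [CompactSpace G],
      IsCompactSimpleLieGroup G → SimplyConnectedSpace G →
      letI : MeasurableSpace G := borel G; haveI : BorelSpace G := ⟨rfl⟩;
      ∀ (r : LatticeRep G) (a : ℝ → ℝ), (∀ β, 0 < a β) → Tendsto a atTop (𝓝 0) → LowerBounds G r a →
        ∃ (n : ℕ) (ε θ C : ℝ), 1 ≤ n ∧ 0 ≤ ε ∧ ε * OnsetFormats.shellCount n ≤ 3 / 4 ∧ 0 < θ ∧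
          ∀ (ℓ₀ : ℕ) (δ : ℝ), 0 < δ → ∃ T B β₂ : ℝ, ∀ β : ℝ, β₂ ≤ β → ∃ b : ℕ, 1 ≤ b ∧ a β * (b : ℝ) < T ∧
            (b : ℝ) ≤ B * Real.exp (C * β) ∧
              ∀ w : Fin 4 → ℤ → ℤ, IsFrame b w →
                ClauseIAll r.ρ β w n ε (TypChain r.ρ θ w ℓ₀) ∧ ClauseIIukp r.ρ β w δ (TypChain r.ρ θ w ℓ₀)) :
    TypChainSharpSC := by
  intro G _ _ _ _ hG hSC
  letI : MeasurableSpace G := borel G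
  haveI : BorelSpace G := ⟨rfl⟩
  intro r a ha ha0 hlb
  obtain ⟨n, ε, θ, C, hn, hε, hM, hθ, hrest⟩ := h G hG hSC r a ha ha0 hlb
  obtain ⟨ℓ₀, hℓ₀⟩ := exists_extent_clauseIII_typChain r hθ C
  refine ⟨n, ε, θ, ℓ₀, hn, hε, hM, fun δ hδ => ?_⟩
  obtain ⟨T, B, β₂, hβ₂⟩ := hrest ℓ₀ δ hδ
  obtain ⟨β₃, hβ₃⟩ := hℓ₀ δ hδ B
  refine ⟨T, max β₂ β₃, fun β hβ => ?_⟩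
  obtain ⟨b, hb, habT, hbB, hw⟩ := hβ₂ β (le_trans (le_max_left _ _) hβ)
  exact ⟨b, hb, habT, fun w hfw =>
    ⟨(hw w hfw).1, (hw w hfw).2, hβ₃ β (le_trans (le_max_right _ _) hβ) b hb hbB w hfw⟩⟩

end PressButton


/-! ## Press-button with a supplier-side LOWER BOUND on the extent (appended): (i)+(ii) for all `ℓ₀ ≥ ℓ₁` suffice -/
section PressButtonFrom

/-- **`TypChainSharpSC` from clauses (i) + (ii) delivered for every extent `ℓ₀ ≥ ℓ₁` (PROVED glue).**  As
`typChainSharpSC_of_clauses_expMesh`, but the supplier may insist on a minimal tolerated extent `ℓ₁` (e.g. R107 compliance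
`insertionTolerant_typChain` wants `60·ℓ_ins ≤ ℓ₀`): the extent of record becomes `ℓ₀ = max ℓ₁ (2⌈48 C⁺/θ⌉₊)`, clause (iii) being inherited
upward by `clauseIII_typChain_mono`. -/
theorem typChainSharpSC_of_clauses_expMesh_from
    (h : ∀ (G : Type) [Group G] [TopologicalSpace G] [IsTopologicalGroup G] [CompactSpace G],
      IsCompactSimpleLieGroup G → SimplyConnectedSpace G →
      letI : MeasurableSpace G := borel G; haveI : BorelSpace G := ⟨rfl⟩;
      ∀ (r : LatticeRep G) (a : ℝ → ℝ), (∀ β, 0 < a β) → Tendsto a atTop (𝓝 0) → LowerBounds G r a →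
        ∃ (n : ℕ) (ε θ C : ℝ) (ℓ₁ : ℕ), 1 ≤ n ∧ 0 ≤ ε ∧ ε * OnsetFormats.shellCount n ≤ 3 / 4 ∧ 0 < θ ∧
          ∀ ℓ₀ : ℕ, ℓ₁ ≤ ℓ₀ → ∀ δ : ℝ, 0 < δ → ∃ T B β₂ : ℝ, ∀ β : ℝ, β₂ ≤ β → ∃ b : ℕ, 1 ≤ b ∧ a β * (b : ℝ) < T ∧
            (b : ℝ) ≤ B * Real.exp (C * β) ∧
              ∀ w : Fin 4 → ℤ → ℤ, IsFrame b w →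
                ClauseIAll r.ρ β w n ε (TypChain r.ρ θ w ℓ₀) ∧ ClauseIIukp r.ρ β w δ (TypChain r.ρ θ w ℓ₀)) :
    TypChainSharpSC := by
  intro G _ _ _ _ hG hSC
  letI : MeasurableSpace G := borel G
  haveI : BorelSpace G := ⟨rfl⟩
  intro r a ha ha0 hlb
  obtain ⟨n, ε, θ, C, ℓ₁, hn, hε, hM, hθ, hrest⟩ := h G hG hSC r a ha ha0 hlb
  obtain ⟨ℓ₀', hℓ₀'⟩ := exists_extent_clauseIII_typChain r hθ C
  refine ⟨n, ε, θ, max ℓ₁ ℓ₀', hn, hε, hM, fun δ hδ => ?_⟩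
  obtain ⟨T, B, β₂, hβ₂⟩ := hrest (max ℓ₁ ℓ₀') (le_max_left _ _) δ hδ
  obtain ⟨β₃, hβ₃⟩ := hℓ₀' δ hδ B
  refine ⟨T, max β₂ β₃, fun β hβ => ?_⟩
  obtain ⟨b, hb, habT, hbB, hw⟩ := hβ₂ β (le_trans (le_max_left _ _) hβ)
  exact ⟨b, hb, habT, fun w hfw => ⟨(hw w hfw).1, (hw w hfw).2,
    clauseIII_typChain_mono le_rfl (le_max_right ℓ₁ ℓ₀') (hβ₃ β (le_trans (le_max_right _ _) hβ) b hb hbB w hfw)⟩⟩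

end PressButtonFrom

end Summit.QuantumFields.YangMills.Cruxes.IR.AfPincerUc.SharpLanes

end
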